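import Literature.NumberTheory.ConnesMoscovici2022.UVProlateSpectrumProofs
import Mathlib.MeasureTheory.Integral.Prod
import HarnessLib

/-!
# Connes–Moscovici 2022, §1: the inhomogeneous toolkit for `dom W_max` — integration by parts
against a primitive, Green's identity in FTC form, passage to the singular points `±λ`

LINE 1 — FRAMING. RH-FREE corpus literature (cell rh-crit, C1 Connes–Consani/Moscovici corpus,
row O2 `UVProlateSpectrum`: the self-adjointness theory of the prolate wave operator
`W_λ = −∂ₓ(λ² − x²)∂ₓ + (2πλx)²`, sequel material with no leaf / binder role in any route).
bears_on: LADDER-RH W-C/W-P.  WHAT THIS IS NOT: any claim about `ζ` or RH; nothing here bears on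
the truth of RH.  Theorems only: 0 `def`s, 0 named facts, no `sorry`.

## What this file is for

The tree's regularity results for `dom W_max` elements are EIGEN-specific (`W_max ξ = μ ξ`, so the
representative solves a classical ODE: `UVProlateSoninProofs`, `UVProlateEigenfunctionEndpoint`,
`UVProlateEigenGreen`, …).  For [ConnesMoscovici2022, Thm 1.6] (= arXiv:2112.05500 Thm 2.6:
"`W_sa` is selfadjoint … commutes with `P_λ`, `P̂_λ` …") one needs the same bookkeeping for a
GENERAL `ξ ∈ dom W_max`, where `W_max ξ = η ∈ L²` is arbitrary and the regular representative
`g` is only `C¹` off `±λ` with `u = p g′` locally absolutely continuous: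
`u(t) − u(s) = ∫_s^t (q g − η)` (the "FTC form"; no second derivative).  Everything below is
stated ABSTRACTLY for such triples `(g, u = p g′, f)` on an interval, so that it applies verbatim
to the representative produced by the enabling regularity lemma
`UVProlateMaxDomainRegularity.exists_regular_repr` (seat cc-t6) and equally to eigenfunctions.
The one-sided limits at `±λ` under the boundary condition (1.19) in the same FTC shape are the
companion module `UVProlateMaxDomainEndpoints` (seat cc-t6) and are not repeated here.

## Contents (all PROVED)

* §1 (private `intervalIntegral_mul_primitive_eq` — Fubini on the triangle
  `∫_x^y ψ(s)(∫_x^s f) ds = ∫_x^y (∫_t^y ψ) f(t) dt`); `intervalIntegral_mul_eq_of_primitive` —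
  **integration by parts against a primitive**: `u(s) = u(x) + ∫_x^s f`, `φ ∈ C¹` ⇒
  `∫_x^y φ f = [φ u]_x^y − ∫_x^y φ′ u` (complex-valued; Mathlib's
  `AbsolutelyContinuousOnInterval.integral_mul_deriv_eq_deriv_mul` is real-valued only).
* §2 `intervalIntegral_lagrange_of_primitive` — **Lagrange's identity (1.5)–(1.6) in FTC form**:
  two triples `(gᵢ, uᵢ = p gᵢ′, fᵢ)` give `∫_x^y (g₁ f₂ − f₁ g₂) = [g₁ u₂ − u₁ g₂]_x^y`;
  `intervalIntegral_green_of_primitive` / `_of_contDiffOn` — **Green's identity for the prolate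
  operator**: `θ ∈ C²` ⇒ `∫_x^y ((Wθ) g − θ (q g − f)) = [θ u − p θ′ g]_x^y`, `Wθ = −(pθ′)′ + qθ`.
* §3 `tendsto_green_boundary_zero` (the boundary term `θ u − p θ′ g` dies at a zero of `p`),
  `intervalIntegral_eq_zero_of_boundary_tendsto_zero` (from Green on `[x, y] ⊂ (a, b)` to
  `∫_a^b = 0`).
* §4 `exists_prolateMax_eq_of_forall_integral` — **the weak equation characterises `dom W_max`**:
  `∫ (Wθ)·G = ∫ θ·H` for all Schwartz `θ` ⇒ `G ∈ dom W_max`, `W_max G = H` (converse of the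
  tree's `integral_prolateSchwartz_mul_eq`; Mathlib `LinearPMap.mem_adjoint_domain_of_exists` /
  `adjoint_apply_eq` and the reality of `W`, `prolateWaveOpFun_star`).

Consumers (planned, seat cc-t14): `W_max(P_λ ξ) = P_λ W_max ξ` on `𝓛_β` and
[ConnesMoscovici2022, Thm 1.6 (ii)] for `P_λ`; symmetry of `W_sa`; the `+∞` asymptotics of
general `dom W_max` elements.

## References

* [ConnesMoscovici2022] A. Connes, H. Moscovici, *The UV prolate spectrum matches the zeros of
  zeta*, PNAS 119 (2022) = arXiv:2112.05500, §1 (= arXiv §2), eqs. (1.2), (1.5)–(1.6), (1.19),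
  Lemma 1.2, Lemma 1.3, Thm 1.6, Cor 1.7 (held text `paper-arxiv-2112.05500`, chunks p0004–p0007).
* [BogachevSmolyanov2020] V. I. Bogachev, O. G. Smolyanov, *Real and Functional Analysis*, Moscow
  Lectures 4, Springer (2020), §4.3–§4.4: Thm 4.3.7 (indefinite integrals = absolutely continuous
  functions), Cor 4.4.4 (Newton–Leibniz), Cor 4.4.5 (integration by parts (4.4.2)) (held text
  `book-anon2020-real-functional-analysis`, p0228, p0231).
-/

noncomputable section

open Complex Set MeasureTheory Filter Topology intervalIntegral SchwartzMap
open scoped Real Topology InnerProductSpace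

namespace Literature.NumberTheory.ConnesMoscovici2022

/-! ## §1. Integration by parts against a primitive -/

section Primitive

/-- **Fubini on the triangle.** For `f ∈ L¹(x, y)` and `ψ` continuous on `[x, y]`,
`∫_x^y ψ(s) (∫_x^s f) ds = ∫_x^y (∫_t^y ψ) f(t) dt`. [folklore] -/
private theorem intervalIntegral_mul_primitive_eq {x y : ℝ} (hxy : x ≤ y) {f ψ : ℝ → ℂ}
    (hf : IntervalIntegrable f volume x y) (hψ : ContinuousOn ψ (Icc x y)) :
    ∫ s in x..y, ψ s * (∫ t in x..s, f t) = ∫ t in x..y, (∫ s in t..y, ψ s) * f t := by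
  set S : Set ℝ := Ioc x y with hS
  have hfS : Integrable f (volume.restrict S) := hf.1
  have hψS : Integrable ψ (volume.restrict S) :=
    (hψ.integrableOn_compact isCompact_Icc).mono_set Ioc_subset_Icc_self
  set K : ℝ → ℝ → ℂ := fun s t ↦ if t ≤ s then ψ s * f t else 0 with hK
  have hKint : Integrable (Function.uncurry K) ((volume.restrict S).prod (volume.restrict S)) := by
    have := (hψS.mul_prod hfS).indicator
      (measurableSet_le measurable_snd measurable_fst : MeasurableSet {p : ℝ × ℝ | p.2 ≤ p.1})
    refine this.congr (Eventually.of_forall fun p ↦ ?_)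
    simp only [Function.uncurry, hK, indicator, mem_setOf_eq]
  have hswap := integral_integral_swap hKint
  have h1 : ∀ s ∈ S, ∫ t in S, K s t = ψ s * ∫ t in x..s, f t := by
    intro s hs
    have e : (fun t ↦ K s t) = fun t ↦ ψ s * (Iic s).indicator f t := by
      funext t; simp only [hK, indicator, mem_Iic]; split_ifs <;> simp
    rw [e, MeasureTheory.integral_const_mul, setIntegral_indicator measurableSet_Iic,
      intervalIntegral.integral_of_le hs.1.le]
    congr 2
    rw [hS, Ioc_inter_Iic, min_eq_right hs.2]
  have h2 : ∀ t ∈ S, ∫ s in S, K s t = (∫ s in t..y, ψ s) * f t := by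
    intro t ht
    have e : (fun s ↦ K s t) = fun s ↦ (Ici t).indicator ψ s * f t := by
      funext s; simp only [hK, indicator, mem_Ici]; split_ifs <;> simp
    rw [e, MeasureTheory.integral_mul_const, setIntegral_indicator measurableSet_Ici]
    have hset : S ∩ Ici t = Icc t y := by
      ext s; simp only [hS, mem_inter_iff, mem_Ioc, mem_Ici, mem_Icc]
      constructor
      · rintro ⟨⟨_, h2⟩, h3⟩; exact ⟨h3, h2⟩
      · rintro ⟨h1, h2⟩; exact ⟨⟨lt_of_lt_of_le ht.1 h1, h2⟩, h1⟩
    rw [hset, integral_Icc_eq_integral_Ioc, ← intervalIntegral.integral_of_le ht.2]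
  rw [intervalIntegral.integral_of_le hxy, intervalIntegral.integral_of_le hxy,
    ← setIntegral_congr_fun measurableSet_Ioc h1, ← setIntegral_congr_fun measurableSet_Ioc h2]
  exact hswap

/-- **Integration by parts against a primitive.**  If `u(s) = u(x) + ∫_x^s f` on `[x, y]`
(`f ∈ L¹(x, y)`; so `u` is an indefinite integral = absolutely continuous with `u′ = f` a.e.
[BogachevSmolyanov2020, Thm 4.3.7 / Cor 4.4.4], but no pointwise derivative is assumed) and
`φ ∈ C¹[x, y]`, then `∫_x^y φ f = φ(y)u(y) − φ(x)u(x) − ∫_x^y φ′ u` — the integration by parts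
formula (4.4.2) for the absolutely continuous pair `(u, φ)`, complex-valued (Mathlib's
`AbsolutelyContinuousOnInterval.integral_mul_deriv_eq_deriv_mul` is real-valued only; proved here
by Fubini on the triangle).
[cite: BogachevSmolyanov2020, Cor 4.4.5 eq. (4.4.2) with Thm 4.3.7 (held text p0231:L16–L22, p0228:L11–L14)] -/
theorem intervalIntegral_mul_eq_of_primitive {x y : ℝ} (hxy : x ≤ y) {f u φ φ' : ℝ → ℂ}
    (hf : IntervalIntegrable f volume x y)
    (hu : ∀ s ∈ Icc x y, u s = u x + ∫ t in x..s, f t)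
    (hφ : ∀ s ∈ Icc x y, HasDerivAt φ (φ' s) s) (hφ' : ContinuousOn φ' (Icc x y)) :
    ∫ t in x..y, φ t * f t = φ y * u y - φ x * u x - ∫ s in x..y, φ' s * u s := by
  have hI : uIcc x y = Icc x y := uIcc_of_le hxy
  have hφc : ContinuousOn φ (Icc x y) := fun s hs ↦ (hφ s hs).continuousAt.continuousWithinAt
  have hφ'i : IntervalIntegrable φ' volume x y := (hφ'.mono hI.subset).intervalIntegrable
  -- FTC for `φ` on `[t, y]`
  have hFTC : ∀ t ∈ Icc x y, ∫ s in t..y, φ' s = φ y - φ t := by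
    intro t ht
    have hsub : uIcc t y ⊆ Icc x y := by
      rw [uIcc_of_le ht.2]; exact Icc_subset_Icc_left ht.1
    exact intervalIntegral.integral_eq_sub_of_hasDerivAt (fun s hs ↦ hφ s (hsub hs))
      ((hφ'.mono hsub).intervalIntegrable)
  -- the primitive is continuous
  have hFc : ContinuousOn (fun s ↦ ∫ t in x..s, f t) (Icc x y) := by
    have := intervalIntegral.continuousOn_primitive_interval (μ := volume) (f := f) (a := x) (b := y)
      (by rw [hI]; exact (intervalIntegrable_iff_integrableOn_Icc_of_le hxy).1 hf)
    rwa [hI] at this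
  -- LHS: `φ t = φ y − ∫_t^y φ′`
  have hL : ∫ t in x..y, φ t * f t =
      φ y * (∫ t in x..y, f t) - ∫ t in x..y, (∫ s in t..y, φ' s) * f t := by
    have e : ∀ t ∈ uIcc x y, φ t * f t = φ y * f t - (∫ s in t..y, φ' s) * f t := by
      intro t ht
      rw [hI] at ht
      rw [hFTC t ht]; ring
    rw [intervalIntegral.integral_congr e, intervalIntegral.integral_sub (hf.const_mul _) ?_,
      intervalIntegral.integral_const_mul]
    refine hf.continuousOn_mul ?_
    rw [hI]
    have : ContinuousOn (fun t ↦ φ y - φ t) (Icc x y) := continuousOn_const.sub hφc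
    exact this.congr fun t ht ↦ hFTC t ht
  -- RHS integral: `u s = u x + ∫_x^s f`, then Fubini
  have hR : ∫ s in x..y, φ' s * u s =
      u x * (φ y - φ x) + ∫ t in x..y, (∫ s in t..y, φ' s) * f t := by
    have e : ∀ s ∈ uIcc x y, φ' s * u s = φ' s * u x + φ' s * (∫ t in x..s, f t) := by
      intro s hs
      rw [hI] at hs
      rw [hu s hs]; ring
    rw [intervalIntegral.integral_congr e, intervalIntegral.integral_add (hφ'i.mul_const _) ?_,
      intervalIntegral.integral_mul_const, hFTC x (left_mem_Icc.2 hxy),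
      intervalIntegral_mul_primitive_eq hxy hf hφ']
    · ring
    · exact hφ'i.mul_continuousOn (by rw [hI]; exact hFc)
  rw [hL, hR, hu y (right_mem_Icc.2 hxy)]
  ring

end Primitive

/-! ## §2. Green's identity in FTC form -/

section Green

/-- The primitive `s ↦ ∫_x^s f` is continuous on `[x, y]`, hence so is any `u` with
`u(s) = u(x) + ∫_x^s f`. [folklore] -/
private theorem continuousOn_of_primitive {x y : ℝ} (hxy : x ≤ y) {u f : ℝ → ℂ}
    (hf : IntervalIntegrable f volume x y) (hu : ∀ s ∈ Icc x y, u s = u x + ∫ t in x..s, f t) :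
    ContinuousOn u (Icc x y) := by
  have hI : uIcc x y = Icc x y := uIcc_of_le hxy
  have hFc : ContinuousOn (fun s ↦ ∫ t in x..s, f t) (Icc x y) := by
    have := intervalIntegral.continuousOn_primitive_interval (μ := volume) (f := f) (a := x)
      (b := y) (by rw [hI]; exact (intervalIntegrable_iff_integrableOn_Icc_of_le hxy).1 hf)
    rwa [hI] at this
  exact (continuousOn_const.add hFc).congr fun s hs ↦ hu s hs

/-- **Lagrange's identity in FTC form (bilinear).** Two triples `(gᵢ, uᵢ, fᵢ)` on `[x, y]` with
`gᵢ ∈ C¹[x, y]`, `uᵢ = p·gᵢ′` and `uᵢ(s) = uᵢ(x) + ∫_x^s fᵢ` (`fᵢ ∈ L¹`; i.e. `(p gᵢ′)′ = fᵢ`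
weakly) satisfy `∫_x^y (g₁ f₂ − f₁ g₂) = [g₁ u₂ − u₁ g₂]_x^y` — the integrated form of
`d/dx [ξ, η] = ξ (pη′)′ − (pξ′)′ η`, `[ξ, η] = p(ξη′ − ηξ′)`, valid without second derivatives.
[cite: ConnesMoscovici2022, §1 eqs. (1.5)–(1.6) (= arXiv:2112.05500 (2.5)–(2.6), chunk p0005:L24–L31)] -/
theorem intervalIntegral_lagrange_of_primitive {x y : ℝ} (hxy : x ≤ y) {p : ℝ → ℂ}
    {g₁ g₁' u₁ f₁ g₂ g₂' u₂ f₂ : ℝ → ℂ}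
    (hg₁ : ∀ s ∈ Icc x y, HasDerivAt g₁ (g₁' s) s) (hg₁' : ContinuousOn g₁' (Icc x y))
    (hu₁ : ∀ s ∈ Icc x y, u₁ s = p s * g₁' s)
    (hF₁ : ∀ s ∈ Icc x y, u₁ s = u₁ x + ∫ t in x..s, f₁ t) (hf₁ : IntervalIntegrable f₁ volume x y)
    (hg₂ : ∀ s ∈ Icc x y, HasDerivAt g₂ (g₂' s) s) (hg₂' : ContinuousOn g₂' (Icc x y))
    (hu₂ : ∀ s ∈ Icc x y, u₂ s = p s * g₂' s)
    (hF₂ : ∀ s ∈ Icc x y, u₂ s = u₂ x + ∫ t in x..s, f₂ t) (hf₂ : IntervalIntegrable f₂ volume x y) :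
    ∫ t in x..y, (g₁ t * f₂ t - f₁ t * g₂ t) =
      (g₁ y * u₂ y - u₁ y * g₂ y) - (g₁ x * u₂ x - u₁ x * g₂ x) := by
  have hI : uIcc x y = Icc x y := uIcc_of_le hxy
  have h12 := intervalIntegral_mul_eq_of_primitive hxy hf₂ hF₂ hg₁ hg₁'
  have h21 := intervalIntegral_mul_eq_of_primitive hxy hf₁ hF₁ hg₂ hg₂'
  have hu₁c := continuousOn_of_primitive hxy hf₁ hF₁
  have hu₂c := continuousOn_of_primitive hxy hf₂ hF₂
  have hg₁c : ContinuousOn g₁ (Icc x y) := fun s hs ↦ (hg₁ s hs).continuousAt.continuousWithinAt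
  have hg₂c : ContinuousOn g₂ (Icc x y) := fun s hs ↦ (hg₂ s hs).continuousAt.continuousWithinAt
  have hi1 : IntervalIntegrable (fun t ↦ g₁ t * f₂ t) volume x y :=
    hf₂.continuousOn_mul (by rw [hI]; exact hg₁c)
  have hi2 : IntervalIntegrable (fun t ↦ f₁ t * g₂ t) volume x y :=
    hf₁.mul_continuousOn (by rw [hI]; exact hg₂c)
  have hcross : ∫ s in x..y, g₁' s * u₂ s = ∫ s in x..y, g₂' s * u₁ s := by
    refine intervalIntegral.integral_congr fun s hs ↦ ?_
    rw [hI] at hs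
    show g₁' s * u₂ s = g₂' s * u₁ s
    rw [hu₁ s hs, hu₂ s hs]; ring
  have e : ∫ t in x..y, f₁ t * g₂ t = ∫ t in x..y, g₂ t * f₁ t := by
    refine intervalIntegral.integral_congr fun s _ ↦ ?_; show f₁ s * g₂ s = g₂ s * f₁ s; ring
  rw [intervalIntegral.integral_sub hi1 hi2, h12, e, h21, hcross]
  ring

/-- `p(x) = λ² − x²` has derivative `−2x`. [folklore] -/
private theorem hasDerivAt_pCoeff_of (lam x : ℝ) :
    HasDerivAt (pCoeff lam) (((-(2 * x) : ℝ) : ℂ)) x := by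
  have h : HasDerivAt (fun y : ℝ ↦ lam ^ 2 - y ^ 2) (-(2 * x)) x := by
    simpa using (hasDerivAt_pow 2 x).const_sub (lam ^ 2)
  have e : pCoeff lam = fun y : ℝ ↦ (((lam ^ 2 - y ^ 2 : ℝ)) : ℂ) := rfl
  rw [e]
  exact h.ofReal_comp

/-- `p` is continuous. [folklore] -/
private theorem continuous_pCoeff (lam : ℝ) : Continuous (pCoeff lam) := by
  have e : pCoeff lam = fun y : ℝ ↦ (((lam ^ 2 - y ^ 2 : ℝ)) : ℂ) := rfl
  rw [e]; fun_prop

/-- **Green's identity in FTC form for the prolate operator (bilinear).** For `θ ∈ C²(ℝ)` and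
`g ∈ C¹[x, y]` with `u = p g′`, `u(s) = u(x) + ∫_x^s f` (for the regular representative of
`ξ ∈ dom W_max`: `f = q g − W_max ξ`), one has
`∫_x^y ((Wθ)·g − θ·(q g − f)) = [θ u − p θ′ g]_x^y`, `Wθ = −(pθ′)′ + qθ` ("using twice integration
by parts"). [cite: ConnesMoscovici2022, §1 eqs. (1.5)–(1.6) and proof of Lemma 1.3 (= arXiv:2112.05500 (2.5)–(2.6), chunk p0005:L24–L31; p0004:L110–L120, p0005:L1–L9)] -/
theorem intervalIntegral_green_of_primitive (lam : ℝ) {x y : ℝ} (hxy : x ≤ y) {θ g u f : ℝ → ℂ}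
    (hθ : ContDiff ℝ 2 θ)
    (hg : ∀ s ∈ Icc x y, HasDerivAt g (deriv g s) s) (hg' : ContinuousOn (deriv g) (Icc x y))
    (hu : ∀ s ∈ Icc x y, u s = pCoeff lam s * deriv g s)
    (hF : ∀ s ∈ Icc x y, u s = u x + ∫ t in x..s, f t) (hf : IntervalIntegrable f volume x y) :
    ∫ t in x..y, ((-deriv (fun s ↦ pCoeff lam s * deriv θ s) t + qCoeff lam t * θ t) * g t
        - θ t * (qCoeff lam t * g t - f t)) =
      (θ y * u y - pCoeff lam y * deriv θ y * g y) -
        (θ x * u x - pCoeff lam x * deriv θ x * g x) := by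
  have hI : uIcc x y = Icc x y := uIcc_of_le hxy
  -- `θ ∈ C²`: `θ′ ∈ C¹`, `θ″` continuous
  have h2 : ContDiff ℝ (1 + 1) θ := by simpa [one_add_one_eq_two] using hθ
  have hθd : Differentiable ℝ θ := (contDiff_succ_iff_deriv.mp h2).1
  have hθ'1 : ContDiff ℝ 1 (deriv θ) := (contDiff_succ_iff_deriv.mp h2).2.2
  have hθ'd : Differentiable ℝ (deriv θ) := hθ'1.differentiable one_ne_zero
  have hθ''c : Continuous (deriv (deriv θ)) := hθ'1.continuous_deriv le_rfl
  -- the classical triple `(θ, pθ′, (pθ′)′)`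
  set u₁ : ℝ → ℂ := fun s ↦ pCoeff lam s * deriv θ s with hu₁
  have hu₁d : ∀ s, HasDerivAt u₁
      (((-(2 * s) : ℝ) : ℂ) * deriv θ s + pCoeff lam s * deriv (deriv θ) s) s := fun s ↦
    (hasDerivAt_pCoeff_of lam s).mul (hθ'd s).hasDerivAt
  have hu₁' : deriv u₁ = fun s ↦ ((-(2 * s) : ℝ) : ℂ) * deriv θ s + pCoeff lam s * deriv (deriv θ) s :=
    funext fun s ↦ (hu₁d s).deriv
  have hu₁'c : Continuous (deriv u₁) := by
    rw [hu₁']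
    exact ((Complex.continuous_ofReal.comp (by fun_prop)).mul (hθ'1.continuous)).add
      ((continuous_pCoeff lam).mul hθ''c)
  have hF₁ : ∀ s ∈ Icc x y, u₁ s = u₁ x + ∫ t in x..s, deriv u₁ t := by
    intro s hs
    rw [intervalIntegral.integral_eq_sub_of_hasDerivAt
      (fun t _ ↦ (hu₁d t).differentiableAt.hasDerivAt) (hu₁'c.intervalIntegrable _ _)]
    ring
  have hL := intervalIntegral_lagrange_of_primitive hxy (p := pCoeff lam)
    (g₁ := θ) (g₁' := deriv θ) (u₁ := u₁) (f₁ := deriv u₁) (g₂ := g) (g₂' := deriv g)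
    (u₂ := u) (f₂ := f)
    (fun s _ ↦ (hθd s).hasDerivAt) (hθ'1.continuous.continuousOn) (fun s _ ↦ rfl) hF₁
    (hu₁'c.intervalIntegrable _ _) hg hg' hu hF hf
  have e : ∀ t ∈ uIcc x y,
      (-deriv (fun s ↦ pCoeff lam s * deriv θ s) t + qCoeff lam t * θ t) * g t
        - θ t * (qCoeff lam t * g t - f t) = θ t * f t - deriv u₁ t * g t := by
    intro t _
    simp only [hu₁]
    ring
  rw [intervalIntegral.integral_congr e, hL]

/-- **Green's identity, component form.**  Same as `intervalIntegral_green_of_primitive`, with the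
hypotheses in the shape produced by the regularity lemma for `dom W_max`: `g ∈ C¹(U)` on an open
`U ⊇ [x, y]` and the FTC form `p(s)g′(s) − p(x)g′(x) = ∫_x^s f` on `[x, y]`.
[cite: ConnesMoscovici2022, §1 eqs. (1.5)–(1.6) and proof of Lemma 1.3 (= arXiv:2112.05500 (2.5)–(2.6), chunk p0005:L24–L31; p0004:L110–L120, p0005:L1–L9)] -/
theorem intervalIntegral_green_of_contDiffOn (lam : ℝ) {x y : ℝ} (hxy : x ≤ y) {U : Set ℝ}
    (hU : IsOpen U) (hxyU : Icc x y ⊆ U) {θ g f : ℝ → ℂ} (hθ : ContDiff ℝ 2 θ)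
    (hg : ContDiffOn ℝ 1 g U)
    (hF : ∀ s ∈ Icc x y, pCoeff lam s * deriv g s - pCoeff lam x * deriv g x = ∫ t in x..s, f t)
    (hf : IntervalIntegrable f volume x y) :
    ∫ t in x..y, ((-deriv (fun s ↦ pCoeff lam s * deriv θ s) t + qCoeff lam t * θ t) * g t
        - θ t * (qCoeff lam t * g t - f t)) =
      (θ y * (pCoeff lam y * deriv g y) - pCoeff lam y * deriv θ y * g y) -
        (θ x * (pCoeff lam x * deriv g x) - pCoeff lam x * deriv θ x * g x) := by
  have hgd : ∀ s ∈ Icc x y, HasDerivAt g (deriv g s) s := fun s hs ↦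
    ((hg.differentiableOn one_ne_zero s (hxyU hs)).differentiableAt (hU.mem_nhds (hxyU hs))).hasDerivAt
  have hg'c : ContinuousOn (deriv g) (Icc x y) :=
    (hg.continuousOn_deriv_of_isOpen hU le_rfl).mono hxyU
  exact intervalIntegral_green_of_primitive lam hxy hθ hgd hg'c (u := fun s ↦ pCoeff lam s * deriv g s)
    (fun s _ ↦ rfl) (fun s hs ↦ by rw [← hF s hs]; ring) hf

end Green

/-! ## §3. Passing to the singular endpoints in Green's identity -/

section Limits

/-- **The boundary term of Green's identity dies at a zero of `p`.**  If `θ ∈ C¹`, `u → 0` and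
`g → c` along a filter `l ≤ 𝓝 a` with `p(a) = 0`, then `θ u − p θ′ g → 0` along `l` — the
mechanism behind "the fact that `(λ² − x²)φ′` and `(λ² − x²)f′` vanish on the boundary".
[cite: ConnesMoscovici2022, proof of Lemma 1.3 (= arXiv:2112.05500 Lemma 2.3, chunk p0004:L110–L120)] -/
theorem tendsto_green_boundary_zero (lam : ℝ) {a : ℝ} (ha : pCoeff lam a = 0) {l : Filter ℝ}
    (hl : l ≤ 𝓝 a) {θ g u : ℝ → ℂ} (hθ : ContDiff ℝ 1 θ) (hu : Tendsto u l (𝓝 0)) {c : ℂ}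
    (hg : Tendsto g l (𝓝 c)) :
    Tendsto (fun s ↦ θ s * u s - pCoeff lam s * deriv θ s * g s) l (𝓝 0) := by
  have hθc : Tendsto θ l (𝓝 (θ a)) := (hθ.continuous.tendsto a).mono_left hl
  have hθ'c : Tendsto (deriv θ) l (𝓝 (deriv θ a)) :=
    ((hθ.continuous_deriv le_rfl).tendsto a).mono_left hl
  have hpc : Tendsto (pCoeff lam) l (𝓝 (pCoeff lam a)) :=
    ((continuous_pCoeff lam).tendsto a).mono_left hl
  have h := (hθc.mul hu).sub ((hpc.mul hθ'c).mul hg)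
  rw [ha] at h
  simpa using h

/-- **From Green on compact subintervals to the whole singular interval.**  If `F ∈ L¹(a, b)`,
`∫_x^y F = B(y) − B(x)` for `a < x ≤ y < b`, and the boundary term `B → 0` at both `a⁺` and `b⁻`,
then `∫_a^b F = 0` — the abstract form of "integration by parts, together with the fact that
`(λ² − x²)φ′(x)` and `(λ² − x²)f′(x)` vanish on the boundary" on the singular interval
`[−λ, λ]`. [cite: ConnesMoscovici2022, proof of Lemma 1.3 (= arXiv:2112.05500 Lemma 2.3, chunk p0004:L110–L120, p0005:L1–L9)] -/
theorem intervalIntegral_eq_zero_of_boundary_tendsto_zero {a b : ℝ} (hab : a < b) {F B : ℝ → ℂ}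
    (hF : IntervalIntegrable F volume a b)
    (hId : ∀ x ∈ Ioo a b, ∀ y ∈ Ioo a b, x ≤ y → ∫ t in x..y, F t = B y - B x)
    (ha : Tendsto B (𝓝[>] a) (𝓝 0)) (hb : Tendsto B (𝓝[<] b) (𝓝 0)) :
    ∫ t in a..b, F t = 0 := by
  set c : ℝ := (a + b) / 2 with hc
  have hcm : c ∈ Ioo a b := ⟨left_lt_add_div_two.2 hab, add_div_two_lt_right.2 hab⟩
  have hI : uIcc a b = Icc a b := uIcc_of_le hab.le
  have hFint : IntegrableOn F (Icc a b) :=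
    (intervalIntegrable_iff_integrableOn_Icc_of_le hab.le).1 hF
  have hFi : ∀ s t, s ∈ Icc a b → t ∈ Icc a b → IntervalIntegrable F volume s t := by
    intro s t hs ht
    exact (hFint.mono_set (by
      rw [uIcc_eq_union]; exact union_subset (Icc_subset_Icc hs.1 ht.2)
        (Icc_subset_Icc ht.1 hs.2))).intervalIntegrable
  -- left half: `∫_a^c F = B c`
  have hleft : ∫ t in a..c, F t = B c := by
    have hcont : ContinuousOn (fun s ↦ ∫ t in s..c, F t) (Icc a b) := by
      have h1 : ContinuousOn (fun s ↦ ∫ t in a..s, F t) (Icc a b) := by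
        have := intervalIntegral.continuousOn_primitive_interval (μ := volume) (f := F) (a := a)
          (b := b) (by rw [hI]; exact hFint)
        rwa [hI] at this
      have e : ∀ s ∈ Icc a b, ∫ t in s..c, F t = (∫ t in a..c, F t) - ∫ t in a..s, F t := by
        intro s hs
        rw [← intervalIntegral.integral_add_adjacent_intervals (hFi a s (left_mem_Icc.2 hab.le) hs)
          (hFi s c hs (Ioo_subset_Icc_self hcm))]
        ring
      exact (continuousOn_const.sub h1).congr e
    have h1 : Tendsto (fun s ↦ ∫ t in s..c, F t) (𝓝[>] a) (𝓝 (∫ t in a..c, F t)) := by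
      have := hcont a (left_mem_Icc.2 hab.le)
      rw [ContinuousWithinAt, nhdsWithin_Icc_eq_nhdsGE hab] at this
      exact this.mono_left (nhdsWithin_mono _ Ioi_subset_Ici_self)
    have h2 : Tendsto (fun s ↦ ∫ t in s..c, F t) (𝓝[>] a) (𝓝 (B c - 0)) := by
      refine (tendsto_const_nhds.sub ha).congr' ?_
      filter_upwards [Ioo_mem_nhdsGT hcm.1] with s hs
      exact (hId s ⟨hs.1, hs.2.trans hcm.2⟩ c hcm hs.2.le).symm
    rw [sub_zero] at h2
    exact tendsto_nhds_unique h1 h2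
  -- right half: `∫_c^b F = −B c`
  have hright : ∫ t in c..b, F t = -B c := by
    have hcont : ContinuousOn (fun s ↦ ∫ t in c..s, F t) (Icc a b) := by
      have := intervalIntegral.continuousOn_primitive_interval' (μ := volume) (f := F)
        (b₁ := a) (b₂ := b) (a := c) hF (by rw [hI]; exact Ioo_subset_Icc_self hcm)
      rwa [hI] at this
    have h1 : Tendsto (fun s ↦ ∫ t in c..s, F t) (𝓝[<] b) (𝓝 (∫ t in c..b, F t)) := by
      have := hcont b (right_mem_Icc.2 hab.le)
      rw [ContinuousWithinAt, nhdsWithin_Icc_eq_nhdsLE hab] at this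
      exact this.mono_left (nhdsWithin_mono _ Iio_subset_Iic_self)
    have h2 : Tendsto (fun s ↦ ∫ t in c..s, F t) (𝓝[<] b) (𝓝 (0 - B c)) := by
      refine (hb.sub tendsto_const_nhds).congr' ?_
      filter_upwards [Ioo_mem_nhdsLT hcm.2] with s hs
      exact (hId c hcm s ⟨hcm.1.trans hs.1, hs.2⟩ hs.1.le).symm
    rw [zero_sub] at h2
    exact tendsto_nhds_unique h1 h2
  rw [← intervalIntegral.integral_add_adjacent_intervals (hFi a c (left_mem_Icc.2 hab.le)
    (Ioo_subset_Icc_self hcm)) (hFi c b (Ioo_subset_Icc_self hcm) (right_mem_Icc.2 hab.le)),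
    hleft, hright, add_neg_cancel]

end Limits

/-! ## §4. Membership in `dom W_max` from the weak equation -/

section Membership

/-- **The weak equation characterises `dom W_max`** (converse of
`integral_prolateSchwartz_mul_eq`): if `G, H ∈ L²(ℝ)` satisfy `∫ (Wθ)·G = ∫ θ·H` for every Schwartz
`θ`, then `G ∈ dom W_max` and `W_max G = H` ("`dom(W_max) = {ξ ∈ L²(ℝ) | Wξ ∈ L²(ℝ)}` with `Wξ`
viewed as a tempered distribution"; `W` is real, so the bilinear and the sesquilinear pairings
carry the same information). [cite: ConnesMoscovici2022, §1 eq. (1.2) (= arXiv:2112.05500 (2.2), chunk p0004:L16–L22)] -/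
theorem exists_prolateMax_eq_of_forall_integral (lam : ℝ) {G H : L2R}
    (h : ∀ θ : 𝓢(ℝ, ℂ), ∫ x, prolateSchwartz lam θ x * G x = ∫ x, θ x * H x) :
    ∃ hG : G ∈ (prolateMax lam).domain, prolateMax lam ⟨G, hG⟩ = H := by
  have key : ∀ x : (prolateCore lam).domain, ⟪H, (x : L2R)⟫_ℂ = ⟪G, prolateCore lam x⟫_ℂ := by
    rintro ⟨x, hx⟩
    obtain ⟨θ, rfl⟩ := LinearMap.mem_range.mp hx
    rw [prolateCore_apply]
    set θc : 𝓢(ℝ, ℂ) := SchwartzMap.postcompCLM (Complex.conjCLE : ℂ →L[ℝ] ℂ) θ with hθc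
    have hθc_apply : ∀ y, θc y = star (θ y) := fun y ↦ rfl
    have hW : ∀ y, prolateSchwartz lam θc y = star (prolateSchwartz lam θ y) := by
      intro y
      rw [prolateSchwartz_apply, prolateSchwartz_apply,
        show (⇑θc : ℝ → ℂ) = fun z ↦ star (θ z) from funext hθc_apply, prolateWaveOpFun_star]
    have hh := h θc
    -- `⟪θ, H⟫ = ∫ θ̄ H = ∫ θc H` and `⟪Wθ, G⟫ = ∫ (Wθc) G`
    have h1 : ⟪(schwartzToL2 θ : L2R), H⟫_ℂ = ∫ y, θc y * H y := by
      change ⟪(θ.toLp 2 volume : L2R), H⟫_ℂ = _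
      rw [L2.inner_def]
      refine integral_congr_ae ?_
      filter_upwards [θ.coeFn_toLp 2 volume] with y hy
      rw [hy, hθc_apply]
      simp [mul_comm]
    have h2 : ⟪(schwartzToL2 (prolateSchwartz lam θ) : L2R), G⟫_ℂ =
        ∫ y, prolateSchwartz lam θc y * G y := by
      change ⟪((prolateSchwartz lam θ).toLp 2 volume : L2R), G⟫_ℂ = _
      rw [L2.inner_def]
      refine integral_congr_ae ?_
      filter_upwards [(prolateSchwartz lam θ).coeFn_toLp 2 volume] with y hy
      rw [hy, hW]
      simp [mul_comm]
    rw [← inner_conj_symm H, ← inner_conj_symm G, h1, h2, hh]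
  have hG : G ∈ (prolateMax lam).domain :=
    LinearPMap.mem_adjoint_domain_of_exists G ⟨H, key⟩
  exact ⟨hG, LinearPMap.adjoint_apply_eq dense_schwartzL2 ⟨G, hG⟩ key⟩

end Membership


end Literature.NumberTheory.ConnesMoscovici2022

end
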